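import Mathlib
import Summits.CriticalPhenomena.Ising3DConformalLimit.Theses.PrimaryAtInfinity
import Summits.CriticalPhenomena.Ising3DConformalLimit.Theorems.PrimaryAtInfinityMultipoleToWardHelpers

/-!
# Route PrimaryAtInfinity · item `MultipoleToWard` — regularity of the far-field coefficients

If `T : (ℝ³)^{n+2} → ℝ` is continuous on non-coincident configurations and has the first-order
far-field expansion `‖y‖^{2Δ+1} T(w, y) - ‖y‖ A₀(w) - ⟪A₁(w), ŷ⟫ → 0` as `‖y‖ → ∞`, locally
uniformly in `w ∈ NonCoincident 3 (n+1)` (the hypothesis shape of items `FirstMultipoleIdentity`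
and `MultipoleToWard` of route `PrimaryAtInfinity`), then the monopole coefficient `A₀` and every
component `w ↦ ⟪A₁ w, b⟫` of the dipole coefficient are continuous on `NonCoincident 3 (n+1)`:
symmetrising / antisymmetrising in `y ↦ -y` exhibits each as a locally uniform limit of continuous
functions. This is what makes the integrals in the weak first-multipole identity honest Bochner
integrals. THEOREM-ONLY file. [folklore]
-/

noncomputable section

namespace Summit.CriticalPhenomena.Ising3DConformalLimit.Theorems.PrimaryAtInfinityMultipoleToWard

open MeasureTheory Filter Set Function Metric Literature.Probability.LatticeModels
open scoped Topology

variable {n : ℕ} {T : (Fin (n + 2) → EuclideanSpace ℝ (Fin 3)) → ℝ}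
  {A₀ : (Fin (n + 1) → EuclideanSpace ℝ (Fin 3)) → ℝ}
  {A₁ : (Fin (n + 1) → EuclideanSpace ℝ (Fin 3)) → EuclideanSpace ℝ (Fin 3)} {Δ : ℝ}

/-- Core of the regularity argument. Around every non-coincident `x`, for every `ε > 0` and every
unit direction `e`, there are a neighbourhood `t` of `x` and a radius `r ≥ 1` such that `± r e`
are admissible far points near `x` (the maps `w ↦ T (w, ± r e)` are continuous at `x`) and the
far-field remainders at `± r e` are `< ε` on `t`. [folklore] -/
theorem farField_core (hT : ContinuousOn T (NonCoincident 3 (n + 2)))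
    (hexp : TendstoLocallyUniformlyOn
      (fun (y : EuclideanSpace ℝ (Fin 3)) (w : Fin (n + 1) → EuclideanSpace ℝ (Fin 3)) =>
        ‖y‖ ^ (2 * Δ + 1) * T (Fin.snoc w y) - ‖y‖ * A₀ w - inner ℝ (A₁ w) (‖y‖⁻¹ • y)) 0
      (cocompact (EuclideanSpace ℝ (Fin 3))) (NonCoincident 3 (n + 1)))
    {x : Fin (n + 1) → EuclideanSpace ℝ (Fin 3)} (hx : x ∈ NonCoincident 3 (n + 1))
    {ε : ℝ} (hε : 0 < ε) {e : EuclideanSpace ℝ (Fin 3)} (he : ‖e‖ = 1) :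
    ∃ t ∈ 𝓝 x, ∃ r : ℝ, 1 ≤ r ∧
      ContinuousAt (fun w : Fin (n + 1) → EuclideanSpace ℝ (Fin 3) =>
        T (Fin.snoc w (r • e))) x ∧
      ContinuousAt (fun w : Fin (n + 1) → EuclideanSpace ℝ (Fin 3) =>
        T (Fin.snoc w (-(r • e)))) x ∧
      ∀ w ∈ t,
        |r ^ (2 * Δ + 1) * T (Fin.snoc w (r • e)) - r * A₀ w - inner ℝ (A₁ w) e| < ε ∧
        |r ^ (2 * Δ + 1) * T (Fin.snoc w (-(r • e))) - r * A₀ w + inner ℝ (A₁ w) e| < ε := by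
  obtain ⟨t, ht, hev⟩ := (Metric.tendstoLocallyUniformlyOn_iff.1 hexp) ε hε x hx
  have ht' : t ∈ 𝓝 x := by
    rwa [(isOpen_nonCoincident 3 (n + 1)).nhdsWithin_eq hx] at ht
  obtain ⟨K, hK, hKU⟩ := mem_cocompact.1 hev
  obtain ⟨R₀, hR₀⟩ := hK.isBounded.subset_closedBall 0
  set r : ℝ := max (max R₀ ‖x‖ + 1) 1 with hr
  have hr1 : 1 ≤ r := le_max_right _ _
  have hr0 : 0 < r := by linarith
  have hrR : R₀ < r := by
    have : max R₀ ‖x‖ + 1 ≤ r := le_max_left _ _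
    have : R₀ ≤ max R₀ ‖x‖ := le_max_left _ _
    linarith
  have hrx : ‖x‖ < r := by
    have : max R₀ ‖x‖ + 1 ≤ r := le_max_left _ _
    have : ‖x‖ ≤ max R₀ ‖x‖ := le_max_right _ _
    linarith
  have hnorm : ‖r • e‖ = r := by
    rw [norm_smul, he, mul_one, Real.norm_of_nonneg hr0.le]
  have hnorm' : ‖-(r • e)‖ = r := by rw [norm_neg, hnorm]
  have hy : r • e ∉ K := fun h => by
    have := hR₀ h
    rw [mem_closedBall, dist_zero_right, hnorm] at this
    linarith
  have hy' : -(r • e) ∉ K := fun h => by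
    have := hR₀ h
    rw [mem_closedBall, dist_zero_right, hnorm'] at this
    linarith
  have hmem : ∀ y : EuclideanSpace ℝ (Fin 3), ‖y‖ = r →
      Fin.snoc x y ∈ NonCoincident 3 (n + 2) := fun y hy =>
    snoc_mem_nonCoincident hx (fun i => by rw [hy]; exact (norm_le_pi_norm x i).trans_lt hrx)
  have hcont : ∀ y : EuclideanSpace ℝ (Fin 3), ‖y‖ = r →
      ContinuousAt (fun w : Fin (n + 1) → EuclideanSpace ℝ (Fin 3) => T (Fin.snoc w y)) x := by
    intro y hy
    have h1 : ContinuousAt T (Fin.snoc x y) :=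
      hT.continuousAt ((isOpen_nonCoincident 3 (n + 2)).mem_nhds (hmem y hy))
    exact ContinuousAt.comp (f := fun w : Fin (n + 1) → EuclideanSpace ℝ (Fin 3) =>
      (Fin.snoc w y : Fin (n + 2) → EuclideanSpace ℝ (Fin 3))) h1
      (continuous_snoc_left y).continuousAt
  have hunit : ‖r • e‖⁻¹ • (r • e) = e := by
    rw [hnorm, smul_smul, inv_mul_cancel₀ hr0.ne', one_smul]
  have hunit' : ‖-(r • e)‖⁻¹ • (-(r • e)) = -e := by
    rw [hnorm', smul_neg, smul_smul, inv_mul_cancel₀ hr0.ne', one_smul]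
  refine ⟨t, ht', r, hr1, hcont _ hnorm, hcont _ hnorm', fun w hw => ⟨?_, ?_⟩⟩
  · have := hKU hy w hw
    rw [Pi.zero_apply, dist_comm, Real.dist_eq, sub_zero, hunit, hnorm] at this
    exact this
  · have := hKU hy' w hw
    rw [Pi.zero_apply, dist_comm, Real.dist_eq, sub_zero, hunit', hnorm', inner_neg_right,
      sub_neg_eq_add] at this
    exact this

/-- **Continuity of the monopole coefficient.** Under the far-field expansion hypothesis, `A₀`
is continuous on non-coincident configurations (it is the locally uniform limit of the
continuous symmetrisations `‖y‖^{2Δ} (T(w, y) + T(w, -y)) / 2`). [folklore] -/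
theorem continuousOn_monopole (hT : ContinuousOn T (NonCoincident 3 (n + 2)))
    (hexp : TendstoLocallyUniformlyOn
      (fun (y : EuclideanSpace ℝ (Fin 3)) (w : Fin (n + 1) → EuclideanSpace ℝ (Fin 3)) =>
        ‖y‖ ^ (2 * Δ + 1) * T (Fin.snoc w y) - ‖y‖ * A₀ w - inner ℝ (A₁ w) (‖y‖⁻¹ • y)) 0
      (cocompact (EuclideanSpace ℝ (Fin 3))) (NonCoincident 3 (n + 1))) :
    ContinuousOn A₀ (NonCoincident 3 (n + 1)) := by
  intro x hx
  apply ContinuousAt.continuousWithinAt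
  apply continuousAt_of_locally_uniform_approx_of_continuousAt
  intro u hu
  obtain ⟨ε, hε, hεu⟩ := Metric.mem_uniformity_dist.1 hu
  obtain ⟨e, he⟩ : ∃ e : EuclideanSpace ℝ (Fin 3), ‖e‖ = 1 :=
    exists_norm_eq (EuclideanSpace ℝ (Fin 3)) zero_le_one
  obtain ⟨t, ht, r, hr1, hc1, hc2, hF⟩ := farField_core hT hexp hx (half_pos hε) he
  refine ⟨t, ht, fun w => (r ^ (2 * Δ + 1) *
    (T (Fin.snoc w (r • e)) + T (Fin.snoc w (-(r • e))))) / (2 * r), ?_, ?_⟩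
  · exact ((hc1.add hc2).const_mul _).div_const _
  · intro w hw
    apply hεu
    obtain ⟨h1, h2⟩ := hF w hw
    have hr0 : 0 < r := by linarith
    set F₁ := r ^ (2 * Δ + 1) * T (Fin.snoc w (r • e)) - r * A₀ w - inner ℝ (A₁ w) e with hF₁
    set F₂ := r ^ (2 * Δ + 1) * T (Fin.snoc w (-(r • e))) - r * A₀ w + inner ℝ (A₁ w) e
      with hF₂
    have hlt : |F₁ + F₂| < ε / 2 + ε / 2 := (abs_add_le _ _).trans_lt (add_lt_add h1 h2)
    have key : A₀ w - r ^ (2 * Δ + 1) * (T (Fin.snoc w (r • e)) + T (Fin.snoc w (-(r • e))))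
        / (2 * r) = -(F₁ + F₂) / (2 * r) := by
      rw [hF₁, hF₂]
      field_simp
      ring
    rw [Real.dist_eq, key, abs_div, abs_neg, abs_of_pos (by positivity : (0 : ℝ) < 2 * r)]
    calc |F₁ + F₂| / (2 * r) ≤ |F₁ + F₂| := div_le_self (abs_nonneg _) (by linarith)
      _ < ε / 2 + ε / 2 := hlt
      _ = ε := add_halves ε

/-- **Continuity of the dipole components.** Under the far-field expansion hypothesis, every
component `w ↦ ⟪A₁ w, b⟫` is continuous on non-coincident configurations (antisymmetrise in
`y ↦ -y` along the direction of `b`). [folklore] -/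
theorem continuousOn_dipole_inner (hT : ContinuousOn T (NonCoincident 3 (n + 2)))
    (hexp : TendstoLocallyUniformlyOn
      (fun (y : EuclideanSpace ℝ (Fin 3)) (w : Fin (n + 1) → EuclideanSpace ℝ (Fin 3)) =>
        ‖y‖ ^ (2 * Δ + 1) * T (Fin.snoc w y) - ‖y‖ * A₀ w - inner ℝ (A₁ w) (‖y‖⁻¹ • y)) 0
      (cocompact (EuclideanSpace ℝ (Fin 3))) (NonCoincident 3 (n + 1)))
    (b : EuclideanSpace ℝ (Fin 3)) :
    ContinuousOn (fun w => inner ℝ (A₁ w) b) (NonCoincident 3 (n + 1)) := by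
  by_cases hb : b = 0
  · simp only [hb, inner_zero_right]
    exact continuousOn_const
  have hbn : 0 < ‖b‖ := norm_pos_iff.2 hb
  set e : EuclideanSpace ℝ (Fin 3) := ‖b‖⁻¹ • b with he_def
  have he : ‖e‖ = 1 := by
    rw [he_def, norm_smul, norm_inv, norm_norm, inv_mul_cancel₀ hbn.ne']
  have hbe : ∀ w, inner ℝ (A₁ w) b = ‖b‖ * inner ℝ (A₁ w) e := by
    intro w
    rw [he_def, inner_smul_right, ← mul_assoc, mul_inv_cancel₀ hbn.ne', one_mul]
  simp_rw [hbe]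
  refine continuousOn_const.mul ?_
  intro x hx
  apply ContinuousAt.continuousWithinAt
  apply continuousAt_of_locally_uniform_approx_of_continuousAt
  intro u hu
  obtain ⟨ε, hε, hεu⟩ := Metric.mem_uniformity_dist.1 hu
  obtain ⟨t, ht, r, hr1, hc1, hc2, hF⟩ := farField_core hT hexp hx (half_pos hε) he
  refine ⟨t, ht, fun w => (r ^ (2 * Δ + 1) *
    (T (Fin.snoc w (r • e)) - T (Fin.snoc w (-(r • e))))) / 2, ?_, ?_⟩
  · exact ((hc1.sub hc2).const_mul _).div_const _
  · intro w hw
    apply hεu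
    obtain ⟨h1, h2⟩ := hF w hw
    set F₁ := r ^ (2 * Δ + 1) * T (Fin.snoc w (r • e)) - r * A₀ w - inner ℝ (A₁ w) e with hF₁
    set F₂ := r ^ (2 * Δ + 1) * T (Fin.snoc w (-(r • e))) - r * A₀ w + inner ℝ (A₁ w) e
      with hF₂
    have hlt : |F₁ - F₂| < ε / 2 + ε / 2 := by
      have := abs_add_le F₁ (-F₂)
      rw [abs_neg, ← sub_eq_add_neg] at this
      exact this.trans_lt (add_lt_add h1 h2)
    have key : inner ℝ (A₁ w) e - r ^ (2 * Δ + 1) *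
        (T (Fin.snoc w (r • e)) - T (Fin.snoc w (-(r • e)))) / 2 = -(F₁ - F₂) / 2 := by
      rw [hF₁, hF₂]
      ring
    rw [Real.dist_eq, key, abs_div, abs_neg, abs_two]
    calc |F₁ - F₂| / 2 ≤ |F₁ - F₂| := div_le_self (abs_nonneg _) (by norm_num)
      _ < ε / 2 + ε / 2 := hlt
      _ = ε := add_halves ε

end Summit.CriticalPhenomena.Ising3DConformalLimit.Theorems.PrimaryAtInfinityMultipoleToWard

end
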